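import Summits.CriticalPhenomena.CardyFormulaZ2.Theorems.CardyComplexConeEdgePrecompactVertexRelationSpliceLoop
import HarnessLib

/-!
# The vertex relation at interior–wired-arc edges, II: the spliced loop's turning number
(line `potential-darboux-picard-diamond` of crux `ParafermionToSLESixFamilies`, stmt-CriticalPhenomena-11389;
second helper file of the stub `stub_vertexRelationArcA` = S1v, `VertexRelationArcA` of `…DiamondDefs.lean`)

The planar input of the per-pair identity behind the vertex relation — the loop `L` through the partner `p₂` of
the dart `p`, spliced into the exploration path when `e = cTgt p` is toggled, turns by `4 · turnSign p` — is
landed as `spliceLoop_turning_eq` (`…EdgePrecompactVertexRelationSpliceLoop.lean`) under the hypothesis that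
all four faces at the far endpoint `y` of `e` are inner. At an edge with `y` on the wired arc `A` (the edges
needed by S1v: fair coins of `bcBondConfig` with one endpoint on `A`, none on `B`, both faces of `e` inner) this
fails, but the tree's proof uses it only through `E.IsInnerFace (cFace p₂)` and `y ∉ E.zdArcB`. This file
re-runs the proof under these two hypotheses (`spliceLoop_turning_eq_arcA`), otherwise verbatim.

References: S. Smirnov, Ann. of Math. 172 (2010), proof of Lemma 4.5, Remark 4.7, Fig. 5; H. Duminil-Copin,
S. Smirnov, arXiv:1109.1549, §8 (Prop. 8.6); G. Grimmett, *The Random-Cluster Model* (2006), §6.1.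
-/

namespace Summit.CriticalPhenomena.CardyFormulaZ2.Cruxes.ParafermionToSLESixFamilies.PotentialDarbouxPicardDiamond

open MeasureTheory Filter Set Metric
open scoped Topology BigOperators Pointwise
open Literature.Probability.LatticeModels Literature.Probability.Percolation
open Literature.Probability.RandomPlanarGeometry (DobrushinDomain)
open Summit.CriticalPhenomena.CardyFormulaZ2.Theses.CardyComplexCone
open Summit.CriticalPhenomena.CardyFormulaZ2.Cruxes.EdgePrecompact.QkzStripBoundaryArm

/-! ## The loop through the partner -/

/-- **The spliced loop turns with the sign of the turn at the toggled edge, at an edge with possibly one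
wired-arc endpoint** (`spliceLoop_turning_eq` of the tree with "all four faces at the far endpoint of `e` inner"
weakened to "the partner's face is inner and the far endpoint is off the free arc `B`"). For the discretisation
`E` of a JORDAN Dobrushin domain (`E.Ω = D.carrier`), admissible, let `p = orb i₁` be a dart of the exploration
path (cut orbit of the start corner `c₀`, exit time `N`) whose partner `p₂` (the other corner arriving at
`e = cTgt p`) is not a dart of the path, the face of `p₂` being inner and the vertex of `p₂` off `B`, and let `Q`
be the minimal period of the cycle `L` of `p₂` under the turning rule. Then `∑_{m<Q} turnSign (orb_L m) =
4 · turnSign p`. Proof: the tree's proof verbatim — `L` consists of inner corners and misses the interface orbit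
(a step of `L` out of the inner faces would cross a face-boundary edge at an `A`-vertex, the unique exit corner,
a dart of the path, or at a `B`-vertex, around which `L` would pivot for ever, putting the vertex of `p₂` on `B`);
the outer face at `e_a` escapes to infinity through non-inner faces (`holeFree_innerFaces`); `chainWinding_eq_zero`
and the signed combinatorial Umlaufsatz give the turning number. The two uses of the strong hypothesis in the tree
(the face of `p₂`; its vertex off `B`) are exactly the two weak hypotheses. -/
theorem spliceLoop_turning_eq_arcA : ∀ (D : DobrushinDomain) (E : DiscreteDobrushin), E.Ω = D.carrier → E.IsZdAdmissible → ∀ (ω : BondConfig (Site 2)) (c₀ p : Site 2 × Fin 4) (N i₁ Q : ℕ), E.IsStartCorner c₀ → ¬ E.IsInnerFace (cFace (cornerOrbit (E.bcBondConfig ω) c₀ N)) → (∀ k < N, E.IsInnerFace (cFace (cornerOrbit (E.bcBondConfig ω) c₀ k))) → cornerOrbit (E.bcBondConfig ω) c₀ i₁ = p → i₁ < N → (∀ i < N, cornerOrbit (E.bcBondConfig ω) c₀ i ≠ cornerPartner p) → E.IsInnerFace (cFace (cornerPartner p)) → p.1 + cornerUnit (p.2 + 1) ∉ E.zdArcB →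 0 < Q → cornerOrbit (E.bcBondConfig ω) (cornerPartner p) Q = cornerPartner p → (∀ s, 0 < s → s < Q → cornerOrbit (E.bcBondConfig ω) (cornerPartner p) s ≠ cornerPartner p) → ∑ m ∈ Finset.range Q, turnSign (E.bcBondConfig ω) (cornerOrbit (E.bcBondConfig ω) (cornerPartner p) m) = 4 * turnSign (E.bcBondConfig ω) p := by
  intro D E hΩ hE ω c₀ p N i₁ Q hc₀ hN hlt hi₁ hi₁N h₂ hp₂f hyB' hQ0 hQ hQmin
  classical
  have hstep : ∀ (c : Site 2 × Fin 4) (i : ℕ), cornerOrbit (E.bcBondConfig ω) c (i + 1) =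
      nextCorner (E.bcBondConfig ω) (cornerOrbit (E.bcBondConfig ω) c i) := fun c i => rfl
  -- the partner, its vertex `y` (off the arc `B`), its (inner) face
  have hp₂in : E.IsInnerFace (cFace (cornerPartner p)) := hp₂f
  have hyB : (cornerPartner p).1 ∉ E.zdArcB := hyB'
  -- `p` is not the last dart
  have hi₁1 : i₁ + 1 < N := by
    by_contra hcon
    have hN1 : N = i₁ + 1 := by omega
    subst hN1
    obtain ⟨-, -, hB, -⟩ := cornerOrbit_exit hE hc₀ (n := i₁) (hlt i₁ hi₁N) hN
    rw [hi₁] at hB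
    exact hyB hB
  -- the interface orbit is periodic; the loop through the partner misses it entirely
  have hc₀mesh : c₀.1 ∈ meshDomain E.Ω E.δ := fst_mem_meshDomain_of_isInnerFace (q := c₀) hc₀.isOutEdge.1
  have hexP : ∃ P, 0 < P ∧ cornerOrbit (E.bcBondConfig ω) c₀ P = c₀ := exists_cornerOrbit_period hE hc₀mesh
  have hP₀0 : 0 < Nat.find hexP := (Nat.find_spec hexP).1
  have hP₀ : cornerOrbit (E.bcBondConfig ω) c₀ (Nat.find hexP) = c₀ := (Nat.find_spec hexP).2
  have hP₀min : ∀ s, 0 < s → s < Nat.find hexP → cornerOrbit (E.bcBondConfig ω) c₀ s ≠ c₀ :=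
    fun s hs hsP h => Nat.find_min hexP hsP ⟨hs, h⟩
  have hdisj : ∀ m s, cornerOrbit (E.bcBondConfig ω) (cornerPartner p) m ≠ cornerOrbit (E.bcBondConfig ω) c₀ s := by
    intro m s h
    obtain ⟨s', hs'⟩ := exists_eq_cornerOrbit_of_iterate hP₀0 hP₀ m h
    have hin : E.IsInnerFace (cFace (cornerOrbit (E.bcBondConfig ω) c₀ s')) := hs' ▸ hp₂in
    rw [isInnerFace_cornerOrbit_iff hE hc₀ hN hlt hP₀0 hP₀ hP₀min] at hin
    exact h₂ _ hin (by rw [cornerOrbit_mod_period hP₀]; exact hs'.symm)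
  -- the loop consists of inner corners
  have hLin : ∀ m, E.IsInnerFace (cFace (cornerOrbit (E.bcBondConfig ω) (cornerPartner p) m)) := by
    intro m
    induction m with
    | zero => exact hp₂in
    | succ m ih =>
      by_contra hout
      set q := cornerOrbit (E.bcBondConfig ω) (cornerPartner p) m with hq
      have hclosed : cTgt q ∉ E.bcBondConfig ω := fun h =>
        hout (by rw [hstep, cFace_nextCorner_of_mem h]; exact ih)
      have hIn : E.IsInEdge q.1 (q.2 + 1) := by
        refine ⟨by rw [fin4_add_one_add_three]; exact ih, ?_⟩
        rwa [hstep, cFace_nextCorner_of_not_mem hclosed] at hout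
      obtain ⟨h1, h2⟩ := hE.arcs_cover_faceBoundary hIn.isFaceBoundaryEdge
      rcases h1 with hA | hB
      · -- `q` would be the exit corner, which lies on the interface orbit
        have hB' : q.1 + cornerUnit (q.2 + 1) ∈ E.zdArcB := by
          rcases h2 with h2 | h2
          · refine absurd (DiscreteDobrushin.mem_bcBondConfig_of_arcA hIn.isFaceBoundaryEdge.1 ?_) hclosed
            intro x hx
            rcases Sym2.mem_iff.1 hx with rfl | rfl
            · exact hA
            · exact h2
          · exact h2
        have hexit : E.IsExitCorner q := ⟨hA, hB', hIn⟩
        obtain ⟨N₁, rfl⟩ : ∃ N₁, N = N₁ + 1 := ⟨N - 1, by omega⟩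
        have hexitN := isExitCorner_cornerOrbit hE hc₀ (hlt N₁ (Nat.lt_succ_self _)) hN
        exact hdisj m N₁ (hexit.eq hE hexitN)
      · -- all target edges at a `B`-vertex are closed: the loop pivots around `q.1` for ever
        have hv : ∀ t, (cornerOrbit (E.bcBondConfig ω) q t).1 = q.1 := by
          intro t
          induction t with
          | zero => rfl
          | succ t iht =>
            rw [hstep, nextCorner_of_not_mem]
            · exact iht
            · exact DiscreteDobrushin.not_mem_bcBondConfig_of_mem_zdArcB hE (Sym2.mem_mk_left _ _) (iht.symm ▸ hB)
        have hper : cornerOrbit (E.bcBondConfig ω) (cornerPartner p) (0 + (m + 1) * Q) = cornerPartner p :=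
          cornerOrbit_add_mul_period hQ 0 (m + 1)
        have hsplit : cornerOrbit (E.bcBondConfig ω) (cornerPartner p) (0 + (m + 1) * Q) =
            cornerOrbit (E.bcBondConfig ω) q ((m + 1) * Q - m) := by
          rw [hq, cornerOrbit_eq_iterate, cornerOrbit_eq_iterate, cornerOrbit_eq_iterate,
            ← Function.iterate_add_apply]
          congr 1
          have : m ≤ (m + 1) * Q := by nlinarith
          omega
        apply hyB
        rw [← hper, hsplit, hv]
        exact hB
  -- bounds: the loop's vertices lie in the finite discrete domain; inner faces are bounded above
  have hΩb : Bornology.IsBounded E.Ω := by rw [hΩ]; exact D.isBounded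
  have hfinD := meshDomain_finite hΩb hE.delta_pos
  obtain ⟨B, hB⟩ := (hfinD.image fun w : Site 2 => w 1 - w 0).bddAbove
  have hBm : ∀ m, (cornerOrbit (E.bcBondConfig ω) (cornerPartner p) m).1 1 -
      (cornerOrbit (E.bcBondConfig ω) (cornerPartner p) m).1 0 ≤ B :=
    fun m => hB ⟨_, fst_mem_meshDomain_of_isInnerFace (hLin m), rfl⟩
  have hfinF : {f : Site 2 | E.IsInnerFace f}.Finite := finite_hasAllSides hΩb hE.delta_pos
  obtain ⟨Y, hY⟩ := (hfinF.image fun f : Site 2 => f 1).bddAbove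
  have hY' : ∀ f, E.IsInnerFace f → f 1 ≤ Y := fun f hf => hY ⟨f, hf, rfl⟩
  -- the outer face at `e_a` escapes to the north (hole-freeness, Jordan curve theorem), then west
  have hg₀ : ¬ E.IsInnerFace (faceAt c₀.1 (c₀.2 + 3)) := hc₀.isOutEdge.2
  obtain ⟨g', hg'Y, hreach⟩ := holeFree_innerFaces D.toJordanDomain hΩ hE.delta_pos _ hg₀ (Y + 1)
  set n : ℕ := (B + 2 - (g' 1 - g' 0)).toNat with hn
  have hreach' : Relation.ReflTransGen (FaceStep {f | E.IsInnerFace f}) (faceAt c₀.1 (c₀.2 + 3))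
      (g' + n • cornerUnit 2) := by
    refine reflTransGen_faceStep_nsmul hg₀ hreach 2 (fun n' hin => ?_) n
    have := hY' _ hin
    simp [cornerUnit] at this
    omega
  have hgfar : B + 2 ≤ (g' + n • cornerUnit 2) 1 - (g' + n • cornerUnit 2) 0 := by
    have : B + 2 - (g' 1 - g' 0) ≤ n := Int.self_le_toNat _
    simp [cornerUnit]
    omega
  -- the corner chain: from far away into `c₀`, then along the path up to the dart after `p`
  obtain ⟨Lb, hLb0, hLbchain, hLbhead, hLblast, hLbface⟩ :=
    exists_chain_of_reach (P := {f | E.IsInnerFace f}) hg₀ (c₀.2 + 3) hreach' 0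
  set M := (List.range (i₁ + 3)).map (cornerOrbit (E.bcBondConfig ω) c₀) with hM
  have hMlen : M.length = i₁ + 3 := by simp [hM]
  have hMget : ∀ (i : ℕ) (h : i < M.length), M[i] = cornerOrbit (E.bcBondConfig ω) c₀ i := by
    intro i h; simp [hM]
  have hchain : (Lb ++ M).IsChain (fun q q' => ∃ β' : BondConfig (Site 2), q' = nextCorner β' q) := by
    refine List.IsChain.append hLbchain (List.isChain_iff_getElem.2 fun i h => ⟨E.bcBondConfig ω, ?_⟩) ?_
    · rw [hMget, hMget, hstep]
    · intro x hx y hy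
      rw [hLblast] at hx
      rw [hM, List.head?_map, List.head?_range] at hy
      simp only [Option.mem_def, Option.some.injEq, Nat.add_eq_zero_iff, OfNat.ofNat_ne_zero, and_false,
        ↓reduceIte, Option.map_some] at hx hy
      subst hx; subst hy
      refine ⟨∅, ?_⟩
      rw [nextCorner_of_not_mem (Set.notMem_empty _), cornerOrbit_zero, faceAt, sub_add_cancel,
        fin4_add_three_add_one]
  have hlen : 2 ≤ (Lb ++ M).length := by rw [List.length_append, hMlen]; omega
  have hoff : ∀ q ∈ Lb ++ M, ∀ m, q ≠ cornerOrbit (E.bcBondConfig ω) (cornerPartner p) m := by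
    intro q hq m hqm
    rcases List.mem_append.1 hq with hq | hq
    · exact hLbface q hq (hqm ▸ hLin m)
    · rw [hM, List.mem_map] at hq
      obtain ⟨i, -, rfl⟩ := hq
      exact hdisj m i hqm.symm
  have hfar : ∀ q ∈ (Lb ++ M).head?, B + 2 ≤ (cFace q) 1 - (cFace q) 0 := by
    intro q hq
    rw [List.head?_append, hLbhead] at hq
    simp only [Option.some_or, Option.mem_def, Option.some.injEq] at hq
    subst hq
    rw [show cFace (g' + n • cornerUnit 2 + cornerOff 0, (0 : Fin 4)) = g' + n • cornerUnit 2 from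
      faceAt_add_cornerOff _ _]
    exact hgfar
  have hidx : Lb.length + (i₁ + 1) + 1 < (Lb ++ M).length := by rw [List.length_append, hMlen]; omega
  obtain ⟨hw1, hw2⟩ := chainWinding_eq_zero (E.bcBondConfig ω) (cornerPartner p) Q (Lb ++ M) B hQ0 hQ hQmin
    hchain hlen hoff hBm hfar (Lb.length + (i₁ + 1)) hidx
  have hget : (Lb ++ M)[Lb.length + (i₁ + 1)] = cornerOrbit (E.bcBondConfig ω) c₀ (i₁ + 1) := by
    rw [List.getElem_append_right (by omega)]
    simp [hM]
  rw [hget] at hw1 hw2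
  -- the dart of the partner on the closed trail of the loop, and the two types of the trail
  have htrail := isTrail_cornerOrbit hQ0 hQ hQmin
  have hperP : (fun m => cpos (cornerOrbit (E.bcBondConfig ω) (cornerPartner p) m)) Q =
      (fun m => cpos (cornerOrbit (E.bcBondConfig ω) (cornerPartner p) m)) 0 := by
    simp only [hQ]; rfl
  have hd₀ : (cpos (cornerPartner p), cpos (nextCorner (E.bcBondConfig ω) (cornerPartner p))) ∈
      MedialTrail.cdarts ((List.range Q).map fun m => cpos (cornerOrbit (E.bcBondConfig ω) (cornerPartner p) m)) := by
    rw [MedialTrail.cdarts_map_range _ hperP, List.mem_map]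
    exact ⟨0, List.mem_range.2 hQ0, rfl⟩
  have hcases := MedialTrail.INV.rf_cases (MedialTrail.inv_of_isTrail _ htrail) htrail hd₀
  rw [lf_cpos_nextCorner, rf_cpos_nextCorner, cturn_cornerOrbit hQ0 hQ hQmin] at hcases
  by_cases hmem : cTgt p ∈ E.bcBondConfig ω
  · -- `e` open: the path follows `e` to the vertex of the partner; left faces agree
    rw [turnSign_of_mem hmem]
    have hv : (cornerOrbit (E.bcBondConfig ω) c₀ (i₁ + 1)).1 = (cornerPartner p).1 := by
      rw [hstep, hi₁, nextCorner_of_mem hmem]; rfl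
    rw [hv] at hw1
    rcases hcases with ⟨-, hl1, -, -⟩ | ⟨-, -, hc4, -⟩
    · rw [hw1] at hl1; exact absurd hl1 (by norm_num)
    · rw [hc4]; norm_num
  · -- `e` closed: the path crosses `e` into the face of the partner; right faces agree
    rw [turnSign_of_not_mem hmem]
    have hf : cFace (cornerOrbit (E.bcBondConfig ω) c₀ (i₁ + 1)) = cFace (cornerPartner p) := by
      rw [hstep, hi₁, cFace_nextCorner_of_not_mem hmem]
      change faceAt p.1 (p.2 + 1) = faceAt (p.1 + cornerUnit (p.2 + 1)) (p.2 + 2)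
      rw [← fin4_add_one_add_one, faceAt_add_unit_succ]
    rw [hf] at hw2
    rcases hcases with ⟨-, -, hc4, -⟩ | ⟨hr1, -, -, -⟩
    · rw [hc4]; norm_num
    · rw [hw2] at hr1; exact absurd hr1 (by norm_num)


end Summit.CriticalPhenomena.CardyFormulaZ2.Cruxes.ParafermionToSLESixFamilies.PotentialDarbouxPicardDiamond
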